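import Literature.AlgebraicGeometry.Modules.FittingIdealSheafRank
import Literature.AlgebraicGeometry.Modules.AffineVectorBundleSections
import Literature.AlgebraicGeometry.Modules.DetClassOfIso
import HarnessLib

/-!
# The flattening stratification of a finite locally free module: `T = ⨆_r T_r` by rank (Stacks 05P9)

Topic `Literature/AlgebraicGeometry/Modules`, namespace `Literature.AlgebraicGeometry.Modules`.  THEOREMS ONLY (no
definition, no instance, no notation, no named fact, no `sorry`).

The Stacks Project, Tag 05P9 (Divisors, Lemma 31.9.7): "Let `S` be a scheme. Let `F` be an `𝒪_S`-module of finite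
presentation. Let `S = Z_{-1} ⊃ Z_0 ⊃ Z_1 ⊃ …` be as in Lemma 31.9.6. Set `S_r = Z_{r-1} ∖ Z_r`. Then `S' = ∐_{r ≥ 0} S_r`
represents the functor `F_flat : Sch/S → Sets, T ↦ {∗}` if `F_T` flat over `T`, `∅` otherwise. Moreover, `F|_{S_r}` is
locally free of rank `r` and the morphisms `S_r → S` and `S' → S` are of finite presentation.  Proof. Suppose that
`g : T → S` is a morphism of schemes such that the pullback `F_T = g^*F` is flat. Then `F_T` is a flat `𝒪_T`-module of
finite presentation. Hence `F_T` is finite locally free, see Properties, Lemma 28.21.2. Thus `T = ∐_{r ≥ 0} T_r`, where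
`F_T|_{T_r}` is locally free of rank `r`. This implies that `F_flat = ∐_{r ≥ 0} F_r` in the category of Zariski
sheaves on `Sch/S` where `F_r` is as in Lemma 31.9.6."

This file proves the DECOMPOSITION the proof consists of (no coproduct of schemes is built), in the currencies of the
tree: `E := f^*F` FINITE LOCALLY FREE (★ `Motives.IsFiniteLocallyFree`, Stacks 01C6 — §0 shows this is exactly
«affine-locally flat of finite presentation», Stacks 00NX) decomposes `T` into the clopen sets
`T_r = {x | rk_x E = r} = (⋂_{k<r} Z_k(E)) ∖ Z_r(E)` (`Z_k(E)` the support of `𝒪_T/Fit_k(E)`, ★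
`Modules/FittingIdealSheafOfModule`), on which `E` has rank `r` (★ `Motives.HasRank`), so that `T_r ↪ T → S` lands in
the rank-`r` stratum of ★ `Modules/LocallyFreeRankLocusRepresentable`:

* §0 `IsFiniteLocallyFree.isAffineLocalizing`, `IsFiniteLocallyFree.isAffineFiniteType`,
  `flat_finitePresentation_sections_of_isFiniteLocallyFree`, **`isFiniteLocallyFree_of_forall_flat_finitePresentation`**
  (Stacks 00NX affine-locally, GW I Cor. 7.42);
* §1 for a frame system `Φ` of `E` (★ `FrameSystem`; e.g. ★ `frameSystemOfIsFiniteLocallyFree hE`):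
  `FrameSystem.fittingIdeal_sections_eq` , **`FrameSystem.mem_support_fittingIdealSheaf_iff`** (`x ∈ Z_k(E) ↔ k < Φ.rank x`
  — so the rank function is frame-independent), `FrameSystem.rank_eq_of_mem`, **`FrameSystem.isClopen_setOf_rank_eq`**,
  **`isClopen_coe_support_fittingIdealSheaf`**, `FrameSystem.setOf_rank_eq_eq`, `FrameSystem.pairwiseDisjoint_setOf_rank_eq`,
  `FrameSystem.iUnion_setOf_rank_eq`;
* §2 **`FrameSystem.hasRank_pullback_stratum`** (`E|_{T_r}` has rank `r`), **`hasRank_pullback_stratum_comp`** and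
  **`fittingIdealSheaf_pullback_stratum_comp`** (`(ι_r ≫ f)^*F` has rank `r`, i.e. `Fit_r = 𝒪`, `Fit_k = 0 (k<r)`: the piece
  `T_r` lands in the locally closed stratum `Z_{r-1}(F) ∖ Z_r(F)`).

Cell `hodgecm-mathlib` (D-0151) count-neutral Mathlib-side capital (F-DAG F-5 (5b) «flattening stratification»,
sheet v1.2); nothing here is about HC — HC_CM is proved only modulo the 7 printed citations until rung 0 closes.

## References

* The Stacks Project, Tags 05P9, 05P8 (Divisors §31.9), 00NX (finite projective = finite locally free), 01C6.
  [StacksProject]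
* U. Görtz, T. Wedhorn, *Algebraic Geometry I*, 2nd ed. (2020), Cor. 7.42, Prop. 7.41. [GortzWedhorn2020]
-/

noncomputable section

-- `TopCat.Presheaf`/`Scheme.Modules` are not reducible (as in Mathlib's `AlgebraicGeometry/Modules`).
set_option backward.isDefEq.respectTransparency false

open CategoryTheory AlgebraicGeometry TopologicalSpace Opposite

universe u

namespace Literature.AlgebraicGeometry.Modules

open Literature.RingTheory.FittingIdeal Literature.AlgebraicGeometry.Motives

variable {T : Scheme.{u}} {E : T.Modules}

/-! ## §0 Finite locally free = affine-locally flat of finite presentation (Stacks 00NX) -/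

/-- A finite locally free module is affine-localizing (it is quasi-coherent). [cite: StacksProject, Tag 01C6 (Modules, Def. 17.14.1 (2))] -/
theorem IsFiniteLocallyFree.isAffineLocalizing (hE : IsFiniteLocallyFree E) : IsAffineLocalizing E := by
  haveI := hE.isVectorBundle.1
  exact IsAffineLocalizing.of_isQuasicoherent E

/-- A finite locally free module is of affine-finite type (GW I Cor. 7.42 (i) ⇒ (ii)). [cite: GortzWedhorn2020, Cor. 7.42] -/
theorem IsFiniteLocallyFree.isAffineFiniteType (hE : IsFiniteLocallyFree E) : IsAffineFiniteType E :=
  fun _ hV => (finite_projective_sections_of_isFiniteLocallyFree hE hV).1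

/-- **Finite locally free ⇒ flat of finite presentation on every affine open** (GW I Cor. 7.42 (i) ⇒ (iii)).
[cite: GortzWedhorn2020, Cor. 7.42] [cite: StacksProject, Tag 00NX] -/
theorem flat_finitePresentation_sections_of_isFiniteLocallyFree (hE : IsFiniteLocallyFree E) {V : T.Opens}
    (hV : IsAffineOpen V) : Module.Flat Γ(T, V) Γ(E, V) ∧ Module.FinitePresentation Γ(T, V) Γ(E, V) := by
  obtain ⟨hfin, hproj⟩ := finite_projective_sections_of_isFiniteLocallyFree hE hV
  exact ⟨Module.Flat.of_projective, Module.finitePresentation_of_projective _ _⟩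

/-- **Affine-locally flat of finite presentation ⇒ finite locally free** (Stacks 00NX: a finitely presented flat module
is finite projective, Mathlib `Module.Flat.projective_of_finitePresentation`; finite projective sections over an affine
open frame an affine-localizing module on basic opens, GW I Cor. 7.42 (iii) ⇒ (i)) — the step «`F_T` flat of finite
presentation, hence finite locally free» of Stacks 05P9. [cite: StacksProject, Tag 00NX] [cite: GortzWedhorn2020, Cor. 7.42] -/
theorem isFiniteLocallyFree_of_forall_flat_finitePresentation (hE : IsAffineLocalizing E)
    (h : ∀ ⦃V : T.Opens⦄, IsAffineOpen V → Module.Flat Γ(T, V) Γ(E, V) ∧ Module.FinitePresentation Γ(T, V) Γ(E, V)) :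
    IsFiniteLocallyFree E := fun x => by
  obtain ⟨_, ⟨V, hV, rfl⟩, hxV, -⟩ := T.isBasis_affineOpens.exists_subset_of_mem_open (Set.mem_univ x) isOpen_univ
  haveI := (h hV).1
  haveI := (h hV).2
  haveI : Module.Projective Γ(T, V) Γ(E, V) := Module.Flat.projective_of_finitePresentation
  obtain ⟨r, hxr, ι, hι, e⟩ := exists_free_over_basicOpen_of_projective_sections hE hV hxV
  exact ⟨T.basicOpen r, hxr, ι, hι, e⟩

/-! ## §1 The rank function of a finite locally free module and the clopen strata -/

namespace FrameSystem

variable (Φ : FrameSystem E) (hE : IsAffineLocalizing E) (hfin : IsAffineFiniteType E)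

/-- The Fitting ideals of the sections over an open inside a frame neighbourhood `U_x`:
`Fit_k(Γ(W, E)) = Γ(W, 𝒪)` if `Φ.rank x ≤ k`, else `0` (Stacks 07Z7). [cite: StacksProject, Tag 07Z7] -/
theorem fittingIdeal_sections_eq {x : T} {W : T.Opens} (hW : W ≤ Φ.U x) (k : ℕ) :
    Module.fittingIdeal Γ(T, W) Γ(E, W) k = if Φ.rank x ≤ k then ⊤ else ⊥ := by
  haveI : Finite (Φ.I x) := Finite.of_equiv _ (Φ.enum x).symm
  exact fittingIdeal_sections_of_frame (by rw [Nat.card_eq_of_equiv_fin (Φ.enum x)]) (Φ.frame x) hW k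

include Φ in
/-- **`x ∈ Z_k(E)` iff `k < rk_x E`**: a point lies in the support of `𝒪_T/Fit_k(E)` iff `k` is less than the size of
any frame of `E` around it. [cite: StacksProject, Tag 05P8] -/
theorem mem_support_fittingIdealSheaf_iff (k : ℕ) (x : T) :
    x ∈ (fittingIdealSheaf E hE hfin k).support ↔ k < Φ.rank x := by
  obtain ⟨W, hW, hxW, hWU⟩ := (Opens.isBasis_iff_nbhd.mp T.isBasis_affineOpens) (Φ.mem x)
  rw [Scheme.IdealSheafData.mem_support_iff_of_mem (U := ⟨W, hW⟩) hxW, ideal_fittingIdealSheaf]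
  change x ∈ T.zeroLocus (U := W) (Module.fittingIdeal Γ(T, W) Γ(E, W) k : Set Γ(T, W)) ↔ _
  rw [Φ.fittingIdeal_sections_eq (hWU.trans le_rfl) k]
  by_cases h : Φ.rank x ≤ k
  · rw [if_pos h, Scheme.mem_zeroLocus_iff]
    constructor
    · intro hz
      exact absurd (by rw [T.basicOpen_of_isUnit isUnit_one]; exact hxW) (hz 1 Submodule.mem_top)
    · intro hk
      exact absurd h (not_le.mpr hk)
  · rw [if_neg h, Scheme.mem_zeroLocus_iff]
    constructor
    · intro _
      exact not_le.mp h
    · rintro - f hf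
      rw [(Submodule.mem_bot _).mp hf, Scheme.basicOpen_zero]
      exact id

include hE hfin in
/-- **The rank of a finite locally free module at a point is well defined**: frames around the same point have the same
size (both compute the Fitting supports). [cite: StacksProject, Tag 0C3G] -/
theorem rank_eq_of_mem {x y : T} (hy : y ∈ Φ.U x) : Φ.rank y = Φ.rank x := by
  -- the frame system with the frame of `x` moved to `y`
  have key : ∀ k, k < Φ.rank y ↔ k < Φ.rank x := fun k => by
    rw [← Φ.mem_support_fittingIdealSheaf_iff hE hfin k y]
    obtain ⟨W, hW, hyW, hWU⟩ :=
      (Opens.isBasis_iff_nbhd.mp T.isBasis_affineOpens) (show y ∈ Φ.U x ⊓ Φ.U y from ⟨hy, Φ.mem y⟩)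
    rw [Scheme.IdealSheafData.mem_support_iff_of_mem (U := ⟨W, hW⟩) hyW, ideal_fittingIdealSheaf]
    change y ∈ T.zeroLocus (U := W) (Module.fittingIdeal Γ(T, W) Γ(E, W) k : Set Γ(T, W)) ↔ _
    rw [Φ.fittingIdeal_sections_eq (hWU.trans inf_le_left) k]
    by_cases h : Φ.rank x ≤ k
    · rw [if_pos h, Scheme.mem_zeroLocus_iff]
      constructor
      · intro hz
        exact absurd (by rw [T.basicOpen_of_isUnit isUnit_one]; exact hyW) (hz 1 Submodule.mem_top)
      · intro hk
        exact absurd h (not_le.mpr hk)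
    · rw [if_neg h, Scheme.mem_zeroLocus_iff]
      constructor
      · intro _
        exact not_le.mp h
      · rintro - f hf
        rw [(Submodule.mem_bot _).mp hf, Scheme.basicOpen_zero]
        exact id
  refine le_antisymm (not_lt.mp fun h => ?_) (not_lt.mp fun h => ?_)
  · exact lt_irrefl _ ((key _).mp h)
  · exact lt_irrefl _ ((key _).mpr h)

include hE hfin in
/-- **The rank strata `T_r = {x | rk_x E = r}` are CLOPEN.** [cite: StacksProject, Tag 05P9] -/
theorem isClopen_setOf_rank_eq (r : ℕ) : IsClopen {x : T | Φ.rank x = r} := by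
  have hopen : ∀ r, IsOpen {x : T | Φ.rank x = r} := fun r => by
    rw [isOpen_iff_forall_mem_open]
    rintro x (hx : Φ.rank x = r)
    exact ⟨Φ.U x, fun y hy => (Φ.rank_eq_of_mem hE hfin hy).trans hx, (Φ.U x).isOpen, Φ.mem x⟩
  refine ⟨⟨?_⟩, hopen r⟩
  have hc : {x : T | Φ.rank x = r}ᶜ = ⋃ r' ∈ {r' | r' ≠ r}, {x : T | Φ.rank x = r'} := by
    ext x
    simp only [Set.mem_compl_iff, Set.mem_setOf_eq, Set.mem_iUnion, exists_prop, exists_eq_right', ne_eq]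
  rw [hc]
  exact isOpen_biUnion fun r' _ => hopen r'

include Φ in
/-- **The Fitting supports `Z_k(E)` of a finite locally free module are CLOPEN.** [cite: StacksProject, Tag 05P9] -/
theorem isClopen_coe_support_fittingIdealSheaf (k : ℕ) :
    IsClopen ((fittingIdealSheaf E hE hfin k).support : Set T) := by
  have h : ((fittingIdealSheaf E hE hfin k).support : Set T) = ⋃ r ∈ {r | k < r}, {x : T | Φ.rank x = r} := by
    ext x
    rw [SetLike.mem_coe, Φ.mem_support_fittingIdealSheaf_iff hE hfin]
    simp only [Set.mem_iUnion, Set.mem_setOf_eq, exists_prop, exists_eq_right']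
  rw [h]
  refine ⟨?_, isOpen_biUnion fun r _ => (Φ.isClopen_setOf_rank_eq hE hfin r).isOpen⟩
  have hc : (⋃ r ∈ {r | k < r}, {x : T | Φ.rank x = r})ᶜ = ⋃ r ∈ {r | ¬ k < r}, {x : T | Φ.rank x = r} := by
    ext x
    simp only [Set.mem_compl_iff, Set.mem_iUnion, Set.mem_setOf_eq, exists_prop, exists_eq_right']
  exact ⟨by rw [hc]; exact isOpen_biUnion fun r _ => (Φ.isClopen_setOf_rank_eq hE hfin r).isOpen⟩

include Φ in
/-- **The strata in Fitting terms**: `{x | rk_x E = r} = (⋂_{k<r} Z_k(E)) ∖ Z_r(E)` — in particular the rank function does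
not depend on the frame system. [cite: StacksProject, Tag 05P9] -/
theorem setOf_rank_eq_eq (r : ℕ) :
    {x : T | Φ.rank x = r} = {x | (∀ k < r, x ∈ (fittingIdealSheaf E hE hfin k).support) ∧
      x ∉ (fittingIdealSheaf E hE hfin r).support} := by
  ext x
  simp only [Set.mem_setOf_eq, Φ.mem_support_fittingIdealSheaf_iff hE hfin, not_lt]
  constructor
  · rintro rfl
    exact ⟨fun k hk => hk, le_rfl⟩
  · rintro ⟨hlt, hle⟩
    exact le_antisymm hle (not_lt.mp fun h => lt_irrefl _ (hlt _ h))

/-- The rank strata are pairwise disjoint. [cite: StacksProject, Tag 05P9] -/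
theorem pairwiseDisjoint_setOf_rank_eq :
    Pairwise (Function.onFun Disjoint fun r : ℕ => {x : T | Φ.rank x = r}) := fun r r' h =>
  Set.disjoint_left.mpr fun x (hx : Φ.rank x = r) (hx' : Φ.rank x = r') => h (hx.symm.trans hx')

/-- The rank strata cover `T`. [cite: StacksProject, Tag 05P9] -/
theorem iUnion_setOf_rank_eq : ⋃ r : ℕ, {x : T | Φ.rank x = r} = Set.univ :=
  Set.eq_univ_of_forall fun x => Set.mem_iUnion.mpr ⟨Φ.rank x, rfl⟩

/-! ## §2 On the stratum `T_r` the module has rank `r` -/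

/-- **`E|_{T_r}` has rank `r`**: for the open subscheme `U ↪ T` with underlying set the stratum `{rk_x E = r}`, the
restriction `ι^*E` has (constant) rank `r` (the pulled-back frame system, ★ `FrameSystem.pullback`).
[cite: StacksProject, Tag 05P9] -/
theorem hasRank_pullback_stratum (U : T.Opens) {r : ℕ} (hU : (U : Set T) ⊆ {x | Φ.rank x = r}) :
    HasRank ((Scheme.Modules.pullback U.ι).obj E) r :=
  (Φ.pullback U.ι).hasRank r fun u => by
    rw [FrameSystem.pullback_rank]
    have hu : U.ι.base u ∈ (U : Set T) := Scheme.Opens.range_ι U ▸ Set.mem_range_self u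
    exact hU hu

end FrameSystem

/-! ### Stacks 05P9 for `E = f^*F` -/

section Pullback

variable {S : Scheme.{u}} {F : S.Modules} (hF : IsAffineLocalizing F) (hfinF : IsAffineFiniteType F) (f : T ⟶ S)
  (Φ : FrameSystem ((Scheme.Modules.pullback f).obj F))

/-- **`(ι_r ≫ f)^*F` has rank `r`** on the stratum `T_r` of `f^*F` (`f^*F` finite locally free, framed by `Φ`).
[cite: StacksProject, Tag 05P9] -/
theorem hasRank_pullback_stratum_comp (U : T.Opens) {r : ℕ} (hU : (U : Set T) ⊆ {x | Φ.rank x = r}) :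
    HasRank ((Scheme.Modules.pullback (U.ι ≫ f)).obj F) r :=
  hasRank_of_iso ((Scheme.Modules.pullbackComp U.ι f).app F) (Φ.hasRank_pullback_stratum U hU)

/-- **Stacks 05P9, decomposition form**: on the clopen stratum `T_r = {rk_x f^*F = r}` (an open subscheme `ι_r : U ↪ T`),
the morphism `ι_r ≫ f : T_r → S` lies in the rank-`r` locally closed stratum of ★ `Modules/LocallyFreeRankLocusRepresentable`:
`Fit_r((ι_r ≫ f)^*F) = 𝒪` and `Fit_k((ι_r ≫ f)^*F) = 0` for `k < r`. [cite: StacksProject, Tag 05P9] -/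
theorem fittingIdealSheaf_pullback_stratum_comp (U : T.Opens) {r : ℕ} (hU : (U : Set T) ⊆ {x | Φ.rank x = r}) :
    fittingIdealSheaf ((Scheme.Modules.pullback (U.ι ≫ f)).obj F) (hF.pullback (U.ι ≫ f))
        (hfinF.pullback (U.ι ≫ f) hF) r = ⊤ ∧
      ∀ k < r, fittingIdealSheaf ((Scheme.Modules.pullback (U.ι ≫ f)).obj F) (hF.pullback (U.ι ≫ f))
        (hfinF.pullback (U.ι ≫ f) hF) k = ⊥ :=
  (hasRank_iff_fittingIdealSheaf _ _ r).mp (hasRank_pullback_stratum_comp f Φ U hU)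

/-- **Stacks 05P9, decomposition form (membership rule of the strata)**: on the stratum `T_r` of `f^*F`, `f` maps into
`S ∖ Z_r(F)` and kills `Fit_k(F)` for `k < r`. [cite: StacksProject, Tag 05P9] [cite: StacksProject, Tag 0C3D] -/
theorem range_stratum_comp_subset_and_le_ker (U : T.Opens) {r : ℕ} (hU : (U : Set T) ⊆ {x | Φ.rank x = r}) :
    Set.range (U.ι ≫ f).base ⊆ ((fittingIdealSheaf F hF hfinF r).support : Set S)ᶜ ∧
      ∀ k < r, fittingIdealSheaf F hF hfinF k ≤ (U.ι ≫ f).ker :=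
  (hasRank_pullback_iff hF hfinF (U.ι ≫ f) r).mp (hasRank_pullback_stratum_comp f Φ U hU)

end Pullback

end Literature.AlgebraicGeometry.Modules

end
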